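/-
Copyright (c) 2026 the pub-hodgecm-mathlib formalisation cell (harness21).  Prover seat hodgecm-mathlib-K2E5-p12 (g2), HCML Track B «K2-LIT», h413 =
`stmt-HodgeConjecture-24833`, line `K2_E3_EllipticInputs`, unit U3b, sub-line (ii♭-H) «RANK-ONE CAYLEY ROAD», letter (Ψ-package₂¹) — brick (α): the
STABLE-CONJUGACY clauses (U2st)(Est)(I)(Sst) of the rank-one Cayley scaling.  2026-09-04.
-/
import Summits.HodgeConjecture.HodgeConjecture.Theorems.K2E3CayleyScalingRankOnePackageHolds   -- ★ (SC₂) chain (this seat) + ★ p855742∕p855813∕p855890 (rank-one ball, (E)(C)(I) API) + ★ Cayley algebra (K2E3-p01)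
import Literature.NumberTheory.Rogawski1990.LocalTransfer                                      -- ★ `IsLocalStablyConjH` (componentwise ★ `IsStablyConj` = conjugacy in the ambient `GL₂(∏_{w∣v} L_w)`)
import HarnessLib

/-!
# h413 ∕ K2-LIT, line `K2_E3_EllipticInputs`, unit U3b, (ii♭-H): THE STABLE-CONJUGACY CLAUSES (U2st)(Est)(I)(Sst) OF THE RANK-ONE CAYLEY SCALING (brick (α) of
# the payer of (Ψ-package₂¹) `sig_K2E3RankOneUnipotentScalingPackageOne`)

Cell `pub/hodgecm-mathlib`, crux H413 = `stmt-HodgeConjecture-24833`; line lead (ii′) K2E4-p06, consumer K2E4-p18 (g3) (`…PackageOfIdentity`), dealers K2E3-plan ∕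
K2E5-plan.  THEOREMS ONLY (no `def`, no `instance`, no `notation`, no named-fact hypothesis, no `sorry`); lane `--supports stmt-HodgeConjecture-24833 --as helper`.

§1 THE MODEL (`U(σ, J)(K)`, rank-one eigenvalue balls `B ⊇ B′` of radii `ρ`, `‖s‖ρ`, the scalings `Ψ` by `s` on `B` and `Θ` by `s⁻¹` on `B′`, letters of ★ p855813):
stable conjugacy in print is conjugacy in the AMBIENT `GL₂`, and the Cayley chart commutes with conjugation by ANY `x ∈ GL₂(K)` (★ `inverseWindow_conj`,
`cayley_conj`, `det_conj_add_one`) — so `B` is stable under ambient conjugation (`mem_ball_of_coe_eq_conj`), `Ψ` is ambient-equivariant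
(`coe_cayleyScaling_eq_conj`), `Ψ ∘ Θ = id` on `B′` (`cayleyScaling_apply_inverse`), and an ambient conjugate `η` of `Ψ u` is `Ψ δ` for the ambient conjugate
`δ := Θ η ∈ B` of `u` (`coe_inverse_eq_conj`).
§2 THE BRIDGE at a non-split `v` (`G = (cmDatum L 2 Φ₂).Local v`, `e = localNonsplitEquiv`): `IsLocalStablyConjH L v (γ, 1) (δ, 1)` ⟺ `e γ`, `e δ` conjugate in
`GL₂(L_w)` (forward: `MonoidHom.map_isConj` along `GL₂(eval_w)`; backward: `eval_w` is a ring isomorphism `∏_{w′∣v} L_{w′} ≃+* L_w` at the unique place,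
Mathlib `RingEquiv.piUnique`).
§3 THE FOUR CLAUSES on `G` for `Ψ_G := e⁻¹ ∘ Ψ ∘ e`, `U₀ := e⁻¹(B)`: (U2st) `mem_of_isLocalStablyConjH`, (Est) `isLocalStablyConjH_map_map`, (I) `injOn_map`, (Sst)
`exists_isLocalStablyConjH_map_eq`.

HONEST LABEL.  HC_CM is proved only modulo the 7 printed citations (2 remaining named inputs: hLiu418 = `stmt-HodgeConjecture-24832`, h413 =
`stmt-HodgeConjecture-24833`) until rung 0 closes; count-neutral helper of the U3b (ii♭-H) sub-line.

## References
* [Rogawski1990] J. D. Rogawski, *Automorphic Representations of Unitary Groups in Three Variables* (1990), §3.1 p. 19 (stable conjugacy = conjugacy in `GL_n`),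
  §8.1 Prop. 8.1.2 (b) p. 114.
* [PlatonovRapinchuk1994] V. Platonov, A. Rapinchuk, *Algebraic Groups and Number Theory* (1994), §3.3 (the Cayley map), §5.1.
* [HarishChandra1999AdmissibleDistributions] Harish-Chandra, *Admissible Invariant Distributions on Reductive p-adic Groups*, ULS 16 (1999), §3.1 Lemma 3.2.
-/

set_option autoImplicit false
set_option linter.dupNamespace false  -- the mandated namespace repeats the single-problem summit's segment (`HodgeConjecture.HodgeConjecture`)

noncomputable section

open NumberField IsDedekindDomain Matrix
open scoped Matrix MatrixGroups
open Literature.NumberTheory.Rogawski1990 Literature.NumberTheory.Automorphic Literature.NumberTheory.Automorphic.UnitaryGroup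
open Literature.NumberTheory.Weil1982.UnitaryFinTopForm Literature.LinearAlgebra.Matrix
open Summit.HodgeConjecture.HodgeConjecture.Cruxes.H413.K2E3CayleyScalingAlgebra
open Summit.HodgeConjecture.HodgeConjecture.Cruxes.H413.K2E3CayleyScalingRankOne Summit.HodgeConjecture.HodgeConjecture.Cruxes.H413.K2E3CayleyScalingRankOneMap

namespace Summit.HodgeConjecture.HodgeConjecture.Cruxes.H413.K2E3CayleyScalingRankOneStable

/-! ## §1 The model: ambient conjugation and the two scalings -/

section Model

variable {K : Type*} [NormedField K] [IsUltrametricDist K] (σ : K →+* K) (J : Matrix (Fin 2) (Fin 2) K) {ρ : ℝ} {s : K}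
  {B : Set ↥(unitaryGroupOfForm σ J)}
  (hB : ∀ u : ↥(unitaryGroupOfForm σ J), u ∈ B ↔
    IsUnit (((u : GL (Fin 2) K) : Matrix (Fin 2) (Fin 2) K) + 1).det ∧
    ‖((((u : GL (Fin 2) K) : Matrix (Fin 2) (Fin 2) K) - 1) * (((u : GL (Fin 2) K) : Matrix (Fin 2) (Fin 2) K) + 1)⁻¹).trace‖ ≤ ρ ∧
    ‖((((u : GL (Fin 2) K) : Matrix (Fin 2) (Fin 2) K) - 1) * (((u : GL (Fin 2) K) : Matrix (Fin 2) (Fin 2) K) + 1)⁻¹).det‖ ≤ ρ ^ 2)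
  {Ψ : ↥(unitaryGroupOfForm σ J) → ↥(unitaryGroupOfForm σ J)}
  (hΨ : ∀ u ∈ B,
    (((Ψ u : ↥(unitaryGroupOfForm σ J)) : GL (Fin 2) K) : Matrix (Fin 2) (Fin 2) K) =
        cayley (s • ((((u : GL (Fin 2) K) : Matrix (Fin 2) (Fin 2) K) - 1) * (((u : GL (Fin 2) K) : Matrix (Fin 2) (Fin 2) K) + 1)⁻¹)) ∧
    ((((Ψ u : ↥(unitaryGroupOfForm σ J)) : GL (Fin 2) K)⁻¹ : GL (Fin 2) K) : Matrix (Fin 2) (Fin 2) K) =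
        cayley (-(s • ((((u : GL (Fin 2) K) : Matrix (Fin 2) (Fin 2) K) - 1) * (((u : GL (Fin 2) K) : Matrix (Fin 2) (Fin 2) K) + 1)⁻¹))))
  {B' : Set ↥(unitaryGroupOfForm σ J)}
  (hB' : ∀ u : ↥(unitaryGroupOfForm σ J), u ∈ B' ↔
    IsUnit (((u : GL (Fin 2) K) : Matrix (Fin 2) (Fin 2) K) + 1).det ∧
    ‖((((u : GL (Fin 2) K) : Matrix (Fin 2) (Fin 2) K) - 1) * (((u : GL (Fin 2) K) : Matrix (Fin 2) (Fin 2) K) + 1)⁻¹).trace‖ ≤ ‖s‖ * ρ ∧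
    ‖((((u : GL (Fin 2) K) : Matrix (Fin 2) (Fin 2) K) - 1) * (((u : GL (Fin 2) K) : Matrix (Fin 2) (Fin 2) K) + 1)⁻¹).det‖ ≤ (‖s‖ * ρ) ^ 2)
  {Θ : ↥(unitaryGroupOfForm σ J) → ↥(unitaryGroupOfForm σ J)}
  (hΘ : ∀ u ∈ B',
    (((Θ u : ↥(unitaryGroupOfForm σ J)) : GL (Fin 2) K) : Matrix (Fin 2) (Fin 2) K) =
        cayley (s⁻¹ • ((((u : GL (Fin 2) K) : Matrix (Fin 2) (Fin 2) K) - 1) * (((u : GL (Fin 2) K) : Matrix (Fin 2) (Fin 2) K) + 1)⁻¹)) ∧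
    ((((Θ u : ↥(unitaryGroupOfForm σ J)) : GL (Fin 2) K)⁻¹ : GL (Fin 2) K) : Matrix (Fin 2) (Fin 2) K) =
        cayley (-(s⁻¹ • ((((u : GL (Fin 2) K) : Matrix (Fin 2) (Fin 2) K) - 1) * (((u : GL (Fin 2) K) : Matrix (Fin 2) (Fin 2) K) + 1)⁻¹))))

include hB in
omit [IsUltrametricDist K] in
/-- **THE BALL IS STABLE UNDER AMBIENT CONJUGATION** (any `x ∈ GL₂(K)`, not only `x ∈ U`): `det(g + 1)`, `tr X_g`, `det X_g` are `GL₂`-conjugation invariants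
(★ `det_conj_add_one`, ★ `inverseWindow_conj`, Mathlib `trace_units_conj` ∕ `det_units_conj`). [cite: Rogawski1990, §3.1 p. 19] [cite: PlatonovRapinchuk1994, §3.3] -/
theorem mem_ball_of_coe_eq_conj {u u' : ↥(unitaryGroupOfForm σ J)} (x : GL (Fin 2) K)
    (h : ((u' : GL (Fin 2) K) : Matrix (Fin 2) (Fin 2) K) = (x : Matrix (Fin 2) (Fin 2) K) * ((u : GL (Fin 2) K) : Matrix (Fin 2) (Fin 2) K) * ((x⁻¹ : GL (Fin 2) K) : Matrix (Fin 2) (Fin 2) K))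
    (hu : u ∈ B) : u' ∈ B := by
  obtain ⟨hP, ht, hd⟩ := (hB u).1 hu
  rw [hB, h, det_conj_add_one, inverseWindow_conj x hP, Matrix.trace_units_conj, Matrix.det_units_conj]
  exact ⟨hP, ht, hd⟩

include hB hΨ in
/-- **THE CAYLEY SCALING IS AMBIENT-EQUIVARIANT**: for `u ∈ B` and `mat u′ = x·mat u·x⁻¹` with ANY `x ∈ GL₂(K)`, `mat(Ψ u′) = x·mat(Ψ u)·x⁻¹` (★ `inverseWindow_conj`,
★ `cayley_conj`; `u′ ∈ B` by `mem_ball_of_coe_eq_conj`). [cite: Rogawski1990, §3.1 p. 19] [cite: PlatonovRapinchuk1994, §3.3] -/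
theorem coe_cayleyScaling_eq_conj (hsρ : ‖s‖ * ρ < 1) {u u' : ↥(unitaryGroupOfForm σ J)} (x : GL (Fin 2) K)
    (h : ((u' : GL (Fin 2) K) : Matrix (Fin 2) (Fin 2) K) = (x : Matrix (Fin 2) (Fin 2) K) * ((u : GL (Fin 2) K) : Matrix (Fin 2) (Fin 2) K) * ((x⁻¹ : GL (Fin 2) K) : Matrix (Fin 2) (Fin 2) K))
    (hu : u ∈ B) :
    (((Ψ u' : ↥(unitaryGroupOfForm σ J)) : GL (Fin 2) K) : Matrix (Fin 2) (Fin 2) K) =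
      (x : Matrix (Fin 2) (Fin 2) K) * (((Ψ u : ↥(unitaryGroupOfForm σ J)) : GL (Fin 2) K) : Matrix (Fin 2) (Fin 2) K) * ((x⁻¹ : GL (Fin 2) K) : Matrix (Fin 2) (Fin 2) K) := by
  have hu' : u' ∈ B := mem_ball_of_coe_eq_conj σ J hB x h hu
  obtain ⟨hP, hm, -⟩ := isUnit_of_mem_ball σ J hB hsρ hu
  have hsm : s • ((x : Matrix (Fin 2) (Fin 2) K) * (((((u : GL (Fin 2) K) : Matrix (Fin 2) (Fin 2) K) - 1) * (((u : GL (Fin 2) K) : Matrix (Fin 2) (Fin 2) K) + 1)⁻¹)) *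
        ((x⁻¹ : GL (Fin 2) K) : Matrix (Fin 2) (Fin 2) K)) =
      (x : Matrix (Fin 2) (Fin 2) K) * (s • ((((u : GL (Fin 2) K) : Matrix (Fin 2) (Fin 2) K) - 1) * (((u : GL (Fin 2) K) : Matrix (Fin 2) (Fin 2) K) + 1)⁻¹)) *
        ((x⁻¹ : GL (Fin 2) K) : Matrix (Fin 2) (Fin 2) K) := by
    rw [Matrix.mul_smul, Matrix.smul_mul]
  rw [(hΨ u' hu').1, (hΨ u hu).1, h, inverseWindow_conj x hP, hsm, cayley_conj x hm]

include hB hΨ hB' hΘ in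
/-- **`Ψ ∘ Θ = id` ON THE SMALL BALL**: for `η ∈ B′`, `Θ η ∈ B` and `Ψ (Θ η) = η` (`X_{Θη} = s⁻¹X_η` ★ `inverseWindow_cayleyScaling`, `c(X_η) = mat η` ★ `cayley_inverseWindow`).
[cite: PlatonovRapinchuk1994, §3.3] -/
theorem cayleyScaling_apply_inverse (h2 : (2 : K) ≠ 0) (hs0 : s ≠ 0) (hρ1 : ρ < 1) {η : ↥(unitaryGroupOfForm σ J)} (hη : η ∈ B') :
    Θ η ∈ B ∧ Ψ (Θ η) = η := by
  have hle : ‖s⁻¹‖ * (‖s‖ * ρ) ≤ ρ := by rw [norm_inv, ← mul_assoc, inv_mul_cancel₀ (norm_ne_zero_iff.2 hs0), one_mul]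
  have hsρ' : ‖s⁻¹‖ * (‖s‖ * ρ) < 1 := lt_of_le_of_lt hle hρ1
  have hmem : Θ η ∈ B := cayleyScaling_mem_of_ball σ J hB' hΘ h2 hsρ' hle hB hη
  refine ⟨hmem, ?_⟩
  obtain ⟨hPη, -, -⟩ := isUnit_of_mem_ball σ J hB' hsρ' hη
  obtain ⟨-, hcay⟩ := cayley_inverseWindow (isUnit_iff_ne_zero.2 h2) hPη
  obtain ⟨-, hX⟩ := inverseWindow_cayleyScaling σ J hB' hΘ h2 hsρ' hη
  apply Subtype.ext; apply Units.ext
  rw [(hΨ _ hmem).1, hX, smul_smul, mul_inv_cancel₀ hs0, one_smul, hcay]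

include hB hΨ hB' hΘ in
/-- **AN AMBIENT CONJUGATE OF `Ψ u` IS `Ψ` OF AN AMBIENT CONJUGATE OF `u`**: for `u ∈ B` and `mat η = x·mat(Ψ u)·x⁻¹` (`x ∈ GL₂(K)` arbitrary), `δ := Θ η` lies in `B`,
`Ψ δ = η`, and `mat δ = x·mat u·x⁻¹` (`X_η = x·sX_u·x⁻¹`, `c(s⁻¹X_η) = x·c(X_u)·x⁻¹ = x·mat u·x⁻¹`). [cite: Rogawski1990, §3.1 p. 19] [cite: PlatonovRapinchuk1994, §3.3] -/
theorem coe_inverse_eq_conj (h2 : (2 : K) ≠ 0) (hs0 : s ≠ 0) (hsρ : ‖s‖ * ρ < 1) (hρ1 : ρ < 1) {u η : ↥(unitaryGroupOfForm σ J)} (hu : u ∈ B) (x : GL (Fin 2) K)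
    (h : ((η : GL (Fin 2) K) : Matrix (Fin 2) (Fin 2) K) =
      (x : Matrix (Fin 2) (Fin 2) K) * (((Ψ u : ↥(unitaryGroupOfForm σ J)) : GL (Fin 2) K) : Matrix (Fin 2) (Fin 2) K) * ((x⁻¹ : GL (Fin 2) K) : Matrix (Fin 2) (Fin 2) K)) :
    Θ η ∈ B ∧ Ψ (Θ η) = η ∧
      (((Θ η : ↥(unitaryGroupOfForm σ J)) : GL (Fin 2) K) : Matrix (Fin 2) (Fin 2) K) =
        (x : Matrix (Fin 2) (Fin 2) K) * ((u : GL (Fin 2) K) : Matrix (Fin 2) (Fin 2) K) * ((x⁻¹ : GL (Fin 2) K) : Matrix (Fin 2) (Fin 2) K) := by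
  have hΨu : Ψ u ∈ B' := cayleyScaling_mem_of_ball σ J hB hΨ h2 hsρ le_rfl hB' hu
  have hη : η ∈ B' := mem_ball_of_coe_eq_conj σ J hB' x h hΨu
  obtain ⟨hmem, hinv⟩ := cayleyScaling_apply_inverse σ J hB hΨ hB' hΘ h2 hs0 hρ1 hη
  refine ⟨hmem, hinv, ?_⟩
  obtain ⟨hP, hm, -⟩ := isUnit_of_mem_ball σ J hB hsρ hu
  obtain ⟨hPΨ, hXΨ⟩ := inverseWindow_cayleyScaling σ J hB hΨ h2 hsρ hu
  obtain ⟨hm₀, hcay⟩ := cayley_inverseWindow (isUnit_iff_ne_zero.2 h2) hP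
  rw [(hΘ η hη).1, h, inverseWindow_conj x hPΨ, hXΨ, Matrix.mul_smul, Matrix.smul_mul, smul_smul, inv_mul_cancel₀ hs0, one_smul, cayley_conj x hm₀, hcay]

end Model

/-! ## §2 The bridge: stable conjugacy in `H_v` on the `U(Φ₂)`-slot is `GL₂(L_w)`-conjugacy of the one-place images -/

section Bridge

variable (L : Type) [Field L] [NumberField L] [IsCMField L] {v : HeightOneSpectrum (𝓞 ↥(maximalRealSubfield L))}
  (w : PlacesOver L v) (hw : IsCMField.complexConj L • w.1 = w.1)

/-- The one-place model on the `GL₂` level: `e γ = GL₂(eval_w)(γ.val)` (★ `coe_localNonsplitEquiv_apply` is `rfl`). [cite: PlatonovRapinchuk1994, §5.1] -/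
theorem coe_localNonsplitEquiv_eq_map (γ : (UnitaryGroup.cmDatum L 2 (Matrix.of fun i j : Fin 2 => if i.val + j.val + 1 = 2 then (1 : L) else 0)).Local v) :
    ((localNonsplitEquiv (IsCMField.complexConj L) (Matrix.of fun i j : Fin 2 => if i.val + j.val + 1 = 2 then (1 : L) else 0) (IsCMField.complexConj_ne_one L) w hw γ :
        ↥(unitaryGroupOfForm (galAdicCompletionMap (L := L) (IsCMField.complexConj L) hw)
          (placeForm (Matrix.of fun i j : Fin 2 => if i.val + j.val + 1 = 2 then (1 : L) else 0) w.1))) : GL (Fin 2) (w.1.adicCompletion L)) =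
      Matrix.GeneralLinearGroup.map (Pi.evalRingHom (fun w' : PlacesOver L v => w'.1.adicCompletion L) w)
        (γ.val : GL (Fin 2) (UnitaryGroup.LocalRing L v)) :=
  Units.ext rfl

set_option maxHeartbeats 800000 in
/-- **FORWARD**: `IsLocalStablyConjH L v (γ, 1) (δ, 1)` — whose `U(Φ₂)`-component is conjugacy of `γ.val`, `δ.val` in `GL₂(∏_{w′∣v} L_{w′})` (★ `IsStablyConj`) — gives
conjugacy of the one-place images `e γ`, `e δ` in `GL₂(L_w)` (Mathlib `MonoidHom.map_isConj` along `GL₂(eval_w)`). [cite: Rogawski1990, §3.1 p. 19] -/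
theorem isConj_coe_localNonsplitEquiv_of_isLocalStablyConjH
    {γ δ : (UnitaryGroup.cmDatum L 2 (Matrix.of fun i j : Fin 2 => if i.val + j.val + 1 = 2 then (1 : L) else 0)).Local v}
    (hst : IsLocalStablyConjH L v (γ, (1 : (UnitaryGroup.cmDatum L 1 (Matrix.of fun i j : Fin 1 => if i.val + j.val + 1 = 1 then (1 : L) else 0)).Local v))
      (δ, (1 : (UnitaryGroup.cmDatum L 1 (Matrix.of fun i j : Fin 1 => if i.val + j.val + 1 = 1 then (1 : L) else 0)).Local v))) :
    IsConj
      ((localNonsplitEquiv (IsCMField.complexConj L) (Matrix.of fun i j : Fin 2 => if i.val + j.val + 1 = 2 then (1 : L) else 0) (IsCMField.complexConj_ne_one L) w hw γ :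
        ↥(unitaryGroupOfForm (galAdicCompletionMap (L := L) (IsCMField.complexConj L) hw)
          (placeForm (Matrix.of fun i j : Fin 2 => if i.val + j.val + 1 = 2 then (1 : L) else 0) w.1))) : GL (Fin 2) (w.1.adicCompletion L))
      ((localNonsplitEquiv (IsCMField.complexConj L) (Matrix.of fun i j : Fin 2 => if i.val + j.val + 1 = 2 then (1 : L) else 0) (IsCMField.complexConj_ne_one L) w hw δ :
        ↥(unitaryGroupOfForm (galAdicCompletionMap (L := L) (IsCMField.complexConj L) hw)
          (placeForm (Matrix.of fun i j : Fin 2 => if i.val + j.val + 1 = 2 then (1 : L) else 0) w.1))) : GL (Fin 2) (w.1.adicCompletion L)) := by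
  have h1 : IsConj (γ.val : GL (Fin 2) (UnitaryGroup.LocalRing L v)) (δ.val : GL (Fin 2) (UnitaryGroup.LocalRing L v)) := hst.1
  rw [coe_localNonsplitEquiv_eq_map, coe_localNonsplitEquiv_eq_map]
  exact (Matrix.GeneralLinearGroup.map (Pi.evalRingHom (fun w' : PlacesOver L v => w'.1.adicCompletion L) w)).map_isConj h1

set_option maxHeartbeats 800000 in
/-- **BACKWARD** (non-split `v`: `w` is the ONLY place above `v`, ★ `PlacesOver.subsingleton_of_smul_eq`): conjugacy of `e γ`, `e δ` in `GL₂(L_w)` gives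
`IsLocalStablyConjH L v (γ, 1) (δ, 1)` — `eval_w : ∏_{w′∣v} L_{w′} ≃+* L_w` (Mathlib `RingEquiv.piUnique`), so `GL₂(eval_w)` is injective with a section.
[cite: Rogawski1990, §3.1 p. 19] [cite: PlatonovRapinchuk1994, §5.1] -/
theorem isLocalStablyConjH_of_isConj_coe_localNonsplitEquiv
    {γ δ : (UnitaryGroup.cmDatum L 2 (Matrix.of fun i j : Fin 2 => if i.val + j.val + 1 = 2 then (1 : L) else 0)).Local v}
    (h : IsConj
      ((localNonsplitEquiv (IsCMField.complexConj L) (Matrix.of fun i j : Fin 2 => if i.val + j.val + 1 = 2 then (1 : L) else 0) (IsCMField.complexConj_ne_one L) w hw γ :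
        ↥(unitaryGroupOfForm (galAdicCompletionMap (L := L) (IsCMField.complexConj L) hw)
          (placeForm (Matrix.of fun i j : Fin 2 => if i.val + j.val + 1 = 2 then (1 : L) else 0) w.1))) : GL (Fin 2) (w.1.adicCompletion L))
      ((localNonsplitEquiv (IsCMField.complexConj L) (Matrix.of fun i j : Fin 2 => if i.val + j.val + 1 = 2 then (1 : L) else 0) (IsCMField.complexConj_ne_one L) w hw δ :
        ↥(unitaryGroupOfForm (galAdicCompletionMap (L := L) (IsCMField.complexConj L) hw)
          (placeForm (Matrix.of fun i j : Fin 2 => if i.val + j.val + 1 = 2 then (1 : L) else 0) w.1))) : GL (Fin 2) (w.1.adicCompletion L))) :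
    IsLocalStablyConjH L v (γ, (1 : (UnitaryGroup.cmDatum L 1 (Matrix.of fun i j : Fin 1 => if i.val + j.val + 1 = 1 then (1 : L) else 0)).Local v))
      (δ, (1 : (UnitaryGroup.cmDatum L 1 (Matrix.of fun i j : Fin 1 => if i.val + j.val + 1 = 1 then (1 : L) else 0)).Local v)) := by
  haveI hquad : Algebra.IsQuadraticExtension ↥(maximalRealSubfield L) L := IsCMField.isQuadraticExtension L
  letI : Unique (PlacesOver L v) :=
    @uniqueOfSubsingleton _ (PlacesOver.subsingleton_of_smul_eq (IsCMField.complexConj L) (IsCMField.complexConj_ne_one L) w hw) w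
  -- the ring isomorphism `eval_w` and the induced section of `GL₂(eval_w)`
  set E : UnitaryGroup.LocalRing L v ≃+* w.1.adicCompletion L := RingEquiv.piUnique (fun w' : PlacesOver L v => w'.1.adicCompletion L) with hE
  have hEapp : ∀ x : UnitaryGroup.LocalRing L v, E x = Pi.evalRingHom (fun w' : PlacesOver L v => w'.1.adicCompletion L) w x := fun _ => rfl
  set φ : GL (Fin 2) (UnitaryGroup.LocalRing L v) →* GL (Fin 2) (w.1.adicCompletion L) :=
    Matrix.GeneralLinearGroup.map (Pi.evalRingHom (fun w' : PlacesOver L v => w'.1.adicCompletion L) w) with hφ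
  set ψ : GL (Fin 2) (w.1.adicCompletion L) →* GL (Fin 2) (UnitaryGroup.LocalRing L v) := Matrix.GeneralLinearGroup.map E.symm.toRingHom with hψ
  have hψφ : ∀ g : GL (Fin 2) (UnitaryGroup.LocalRing L v), ψ (φ g) = g := by
    intro g
    refine Units.ext (Matrix.ext fun i j => ?_)
    show E.symm (Pi.evalRingHom (fun w' : PlacesOver L v => w'.1.adicCompletion L) w ((g : Matrix (Fin 2) (Fin 2) (UnitaryGroup.LocalRing L v)) i j)) = _
    rw [← hEapp, RingEquiv.symm_apply_apply]
  rw [coe_localNonsplitEquiv_eq_map, coe_localNonsplitEquiv_eq_map] at h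
  have h2 : IsConj (γ.val : GL (Fin 2) (UnitaryGroup.LocalRing L v)) (δ.val : GL (Fin 2) (UnitaryGroup.LocalRing L v)) := by
    have h' := ψ.map_isConj h
    rwa [← hφ, hψφ, hψφ] at h'
  exact ⟨h2, IsConj.refl _⟩

end Bridge

/-! ## §3 The four clauses on `G = U(Φ₂)(L⁺_v)` for `Ψ_G = e⁻¹ ∘ Ψ ∘ e`, `U₀ = e⁻¹(B)` -/

section Clauses

variable (L : Type) [Field L] [NumberField L] [IsCMField L] {v : HeightOneSpectrum (𝓞 ↥(maximalRealSubfield L))}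
  (w : PlacesOver L v) (hw : IsCMField.complexConj L • w.1 = w.1) {ρ : ℝ} {s : w.1.adicCompletion L}
  {B : Set ↥(unitaryGroupOfForm (galAdicCompletionMap (L := L) (IsCMField.complexConj L) hw) (placeForm (Matrix.of fun i j : Fin 2 => if i.val + j.val + 1 = 2 then (1 : L) else 0) w.1))}
  (hB : ∀ u : ↥(unitaryGroupOfForm (galAdicCompletionMap (L := L) (IsCMField.complexConj L) hw) (placeForm (Matrix.of fun i j : Fin 2 => if i.val + j.val + 1 = 2 then (1 : L) else 0) w.1)), u ∈ B ↔
    IsUnit ((((u : ↥(unitaryGroupOfForm (galAdicCompletionMap (L := L) (IsCMField.complexConj L) hw) (placeForm (Matrix.of fun i j : Fin 2 => if i.val + j.val + 1 = 2 then (1 : L) else 0) w.1))) : GL (Fin 2) (w.1.adicCompletion L)) : Matrix (Fin 2) (Fin 2) (w.1.adicCompletion L)) + 1).det ∧ ‖(((((u : ↥(unitaryGroupOfForm (galAdicCompletionMap (L := L) (IsCMField.complexConj L) hw) (placeForm (Matrix.of fun i j : Fin 2 => if i.val + j.val + 1 = 2 then (1 : L) else 0) w.1))) : GL (Fin 2)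 (w.1.adicCompletion L)) : Matrix (Fin 2) (Fin 2) (w.1.adicCompletion L)) - 1) * ((((u : ↥(unitaryGroupOfForm (galAdicCompletionMap (L := L) (IsCMField.complexConj L) hw) (placeForm (Matrix.of fun i j : Fin 2 => if i.val + j.val + 1 = 2 then (1 : L) else 0) w.1))) : GL (Fin 2) (w.1.adicCompletion L)) : Matrix (Fin 2) (Fin 2) (w.1.adicCompletion L)) + 1)⁻¹).trace‖ ≤ ρ ∧ ‖(((((u : ↥(unitaryGroupOfForm (galAdicCompletionMap (L := L) (IsCMField.complexConj L) hw) (placeForm (Matrix.of fun i j : Fin 2 => if i.val + j.val + 1 = 2 then (1 : L) else 0) w.1))) : GL (Fin 2) (w.1.adicCompletion L)) : Matrix (Fin 2) (Fin 2) (w.1.adicCompletion L)) - 1) * ((((u : ↥(unitaryGroupOfForm (galAdicCompletionMap (L := L) (IsCMField.complexConj L) hw) (placeForm (Matrix.of fun i j : Fin 2 => if i.val + j.val + 1 = 2 then (1 : L) else 0) w.1))) : GL (Fin 2) (w.1.adicCompletion L)) : Matrix (Fin 2) (Fin 2) (w.1.adicCompletion L)) + 1)⁻¹).det‖ ≤ ρ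 ^ 2)
  {Ψ : ↥(unitaryGroupOfForm (galAdicCompletionMap (L := L) (IsCMField.complexConj L) hw) (placeForm (Matrix.of fun i j : Fin 2 => if i.val + j.val + 1 = 2 then (1 : L) else 0) w.1)) → ↥(unitaryGroupOfForm (galAdicCompletionMap (L := L) (IsCMField.complexConj L) hw) (placeForm (Matrix.of fun i j : Fin 2 => if i.val + j.val + 1 = 2 then (1 : L) else 0) w.1))}
  (hΨ : ∀ u ∈ B, (((Ψ u : ↥(unitaryGroupOfForm (galAdicCompletionMap (L := L) (IsCMField.complexConj L) hw) (placeForm (Matrix.of fun i j : Fin 2 => if i.val + j.val + 1 = 2 then (1 : L) else 0) w.1))) : GL (Fin 2) (w.1.adicCompletion L)) : Matrix (Fin 2) (Fin 2) (w.1.adicCompletion L)) = cayley (s • (((((u : ↥(unitaryGroupOfForm (galAdicCompletionMap (L := L) (IsCMField.complexConj L) hw) (placeForm (Matrix.of fun i j : Fin 2 => if i.val + j.val + 1 = 2 then (1 : L) else 0) w.1))) : GL (Fin 2) (w.1.adicCompletion L)) : Matrix (Fin 2) (Fin 2) (w.1.adicCompletion L)) - 1) * ((((u : ↥(unitaryGroupOfForm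 (galAdicCompletionMap (L := L) (IsCMField.complexConj L) hw) (placeForm (Matrix.of fun i j : Fin 2 => if i.val + j.val + 1 = 2 then (1 : L) else 0) w.1))) : GL (Fin 2) (w.1.adicCompletion L)) : Matrix (Fin 2) (Fin 2) (w.1.adicCompletion L)) + 1)⁻¹)) ∧
    (((((Ψ u : ↥(unitaryGroupOfForm (galAdicCompletionMap (L := L) (IsCMField.complexConj L) hw) (placeForm (Matrix.of fun i j : Fin 2 => if i.val + j.val + 1 = 2 then (1 : L) else 0) w.1))) : GL (Fin 2) (w.1.adicCompletion L)))⁻¹ : GL (Fin 2) (w.1.adicCompletion L)) : Matrix (Fin 2) (Fin 2) (w.1.adicCompletion L)) = cayley (-(s • (((((u : ↥(unitaryGroupOfForm (galAdicCompletionMap (L := L) (IsCMField.complexConj L) hw) (placeForm (Matrix.of fun i j : Fin 2 => if i.val + j.val + 1 = 2 then (1 : L) else 0) w.1))) : GL (Fin 2) (w.1.adicCompletion L)) : Matrix (Fin 2) (Fin 2) (w.1.adicCompletion L)) - 1) * ((((u : ↥(unitaryGroupOfForm (galAdicCompletionMap (L := L) (IsCMField.complexConj L) hw) (placeForm (Matrix.of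 fun i j : Fin 2 => if i.val + j.val + 1 = 2 then (1 : L) else 0) w.1))) : GL (Fin 2) (w.1.adicCompletion L)) : Matrix (Fin 2) (Fin 2) (w.1.adicCompletion L)) + 1)⁻¹))))
  {B' : Set ↥(unitaryGroupOfForm (galAdicCompletionMap (L := L) (IsCMField.complexConj L) hw) (placeForm (Matrix.of fun i j : Fin 2 => if i.val + j.val + 1 = 2 then (1 : L) else 0) w.1))}
  (hB' : ∀ u : ↥(unitaryGroupOfForm (galAdicCompletionMap (L := L) (IsCMField.complexConj L) hw) (placeForm (Matrix.of fun i j : Fin 2 => if i.val + j.val + 1 = 2 then (1 : L) else 0) w.1)), u ∈ B' ↔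
    IsUnit ((((u : ↥(unitaryGroupOfForm (galAdicCompletionMap (L := L) (IsCMField.complexConj L) hw) (placeForm (Matrix.of fun i j : Fin 2 => if i.val + j.val + 1 = 2 then (1 : L) else 0) w.1))) : GL (Fin 2) (w.1.adicCompletion L)) : Matrix (Fin 2) (Fin 2) (w.1.adicCompletion L)) + 1).det ∧ ‖(((((u : ↥(unitaryGroupOfForm (galAdicCompletionMap (L := L) (IsCMField.complexConj L) hw) (placeForm (Matrix.of fun i j : Fin 2 => if i.val + j.val + 1 = 2 then (1 : L) else 0) w.1))) : GL (Fin 2) (w.1.adicCompletion L)) : Matrix (Fin 2) (Fin 2) (w.1.adicCompletion L)) - 1) * ((((u : ↥(unitaryGroupOfForm (galAdicCompletionMap (L := L) (IsCMField.complexConj L) hw) (placeForm (Matrix.of fun i j : Fin 2 => if i.val + j.val + 1 = 2 then (1 : L) else 0) w.1))) : GL (Fin 2) (w.1.adicCompletion L)) : Matrix (Fin 2) (Fin 2) (w.1.adicCompletion L)) + 1)⁻¹).trace‖ ≤ ‖s‖ * ρ ∧ ‖(((((u : ↥(unitaryGroupOfForm (galAdicCompletionMap (L := L) (IsCMField.complexConj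 L) hw) (placeForm (Matrix.of fun i j : Fin 2 => if i.val + j.val + 1 = 2 then (1 : L) else 0) w.1))) : GL (Fin 2) (w.1.adicCompletion L)) : Matrix (Fin 2) (Fin 2) (w.1.adicCompletion L)) - 1) * ((((u : ↥(unitaryGroupOfForm (galAdicCompletionMap (L := L) (IsCMField.complexConj L) hw) (placeForm (Matrix.of fun i j : Fin 2 => if i.val + j.val + 1 = 2 then (1 : L) else 0) w.1))) : GL (Fin 2) (w.1.adicCompletion L)) : Matrix (Fin 2) (Fin 2) (w.1.adicCompletion L)) + 1)⁻¹).det‖ ≤ (‖s‖ * ρ) ^ 2)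
  {Θ : ↥(unitaryGroupOfForm (galAdicCompletionMap (L := L) (IsCMField.complexConj L) hw) (placeForm (Matrix.of fun i j : Fin 2 => if i.val + j.val + 1 = 2 then (1 : L) else 0) w.1)) → ↥(unitaryGroupOfForm (galAdicCompletionMap (L := L) (IsCMField.complexConj L) hw) (placeForm (Matrix.of fun i j : Fin 2 => if i.val + j.val + 1 = 2 then (1 : L) else 0) w.1))}
  (hΘ : ∀ u ∈ B', (((Θ u : ↥(unitaryGroupOfForm (galAdicCompletionMap (L := L) (IsCMField.complexConj L) hw) (placeForm (Matrix.of fun i j : Fin 2 => if i.val + j.val + 1 = 2 then (1 : L) else 0) w.1))) : GL (Fin 2) (w.1.adicCompletion L)) : Matrix (Fin 2) (Fin 2) (w.1.adicCompletion L)) = cayley (s⁻¹ • (((((u : ↥(unitaryGroupOfForm (galAdicCompletionMap (L := L) (IsCMField.complexConj L) hw) (placeForm (Matrix.of fun i j : Fin 2 => if i.val + j.val + 1 = 2 then (1 : L) else 0) w.1))) : GL (Fin 2) (w.1.adicCompletion L)) : Matrix (Fin 2) (Fin 2) (w.1.adicCompletion L)) - 1) * ((((u : ↥(unitaryGroupOfForm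 (galAdicCompletionMap (L := L) (IsCMField.complexConj L) hw) (placeForm (Matrix.of fun i j : Fin 2 => if i.val + j.val + 1 = 2 then (1 : L) else 0) w.1))) : GL (Fin 2) (w.1.adicCompletion L)) : Matrix (Fin 2) (Fin 2) (w.1.adicCompletion L)) + 1)⁻¹)) ∧
    (((((Θ u : ↥(unitaryGroupOfForm (galAdicCompletionMap (L := L) (IsCMField.complexConj L) hw) (placeForm (Matrix.of fun i j : Fin 2 => if i.val + j.val + 1 = 2 then (1 : L) else 0) w.1))) : GL (Fin 2) (w.1.adicCompletion L)))⁻¹ : GL (Fin 2) (w.1.adicCompletion L)) : Matrix (Fin 2) (Fin 2) (w.1.adicCompletion L)) = cayley (-(s⁻¹ • (((((u : ↥(unitaryGroupOfForm (galAdicCompletionMap (L := L) (IsCMField.complexConj L) hw) (placeForm (Matrix.of fun i j : Fin 2 => if i.val + j.val + 1 = 2 then (1 : L) else 0) w.1))) : GL (Fin 2) (w.1.adicCompletion L)) : Matrix (Fin 2) (Fin 2) (w.1.adicCompletion L)) - 1) * ((((u : ↥(unitaryGroupOfForm (galAdicCompletionMap (L := L) (IsCMField.complexConj L) hw) (placeForm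 (Matrix.of fun i j : Fin 2 => if i.val + j.val + 1 = 2 then (1 : L) else 0) w.1))) : GL (Fin 2) (w.1.adicCompletion L)) : Matrix (Fin 2) (Fin 2) (w.1.adicCompletion L)) + 1)⁻¹))))

include hB in
set_option maxHeartbeats 800000 in
/-- **(U2st)**: `U₀ = e⁻¹(B)` is stable under STABLE conjugacy on the `U(Φ₂)`-slot of `H_v` (§2 forward + §1 `mem_ball_of_coe_eq_conj`). [cite: Rogawski1990, §3.1 p. 19] -/
theorem mem_of_isLocalStablyConjH {γ : (UnitaryGroup.cmDatum L 2 (Matrix.of fun i j : Fin 2 => if i.val + j.val + 1 = 2 then (1 : L) else 0)).Local v} (hγ : (localNonsplitEquiv (IsCMField.complexConj L) (Matrix.of fun i j : Fin 2 => if i.val + j.val + 1 = 2 then (1 : L) else 0) (IsCMField.complexConj_ne_one L) w hw) γ ∈ B) (δ : (UnitaryGroup.cmDatum L 2 (Matrix.of fun i j : Fin 2 => if i.val + j.val + 1 = 2 then (1 : L) else 0)).Local v)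
    (hst : IsLocalStablyConjH L v (γ, (1 : (UnitaryGroup.cmDatum L 1 (Matrix.of fun i j : Fin 1 => if i.val + j.val + 1 = 1 then (1 : L) else 0)).Local v)) (δ, (1 : (UnitaryGroup.cmDatum L 1 (Matrix.of fun i j : Fin 1 => if i.val + j.val + 1 = 1 then (1 : L) else 0)).Local v))) : (localNonsplitEquiv (IsCMField.complexConj L) (Matrix.of fun i j : Fin 2 => if i.val + j.val + 1 = 2 then (1 : L) else 0) (IsCMField.complexConj_ne_one L) w hw) δ ∈ B := by
  obtain ⟨x, hx⟩ := isConj_iff.1 (isConj_coe_localNonsplitEquiv_of_isLocalStablyConjH L w hw hst)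
  exact mem_ball_of_coe_eq_conj _ _ hB x (by rw [← hx, Units.val_mul, Units.val_mul]) hγ

include hB hΨ in
set_option maxHeartbeats 800000 in
/-- **(Est)**: `Ψ_G = e⁻¹ ∘ Ψ ∘ e` preserves STABLE conjugacy on `U₀` (§2 both ways + §1 `coe_cayleyScaling_eq_conj`). [cite: Rogawski1990, §3.1 p. 19] -/
theorem isLocalStablyConjH_map_map (hsρ : ‖s‖ * ρ < 1) {γ δ : (UnitaryGroup.cmDatum L 2 (Matrix.of fun i j : Fin 2 => if i.val + j.val + 1 = 2 then (1 : L) else 0)).Local v} (hγ : (localNonsplitEquiv (IsCMField.complexConj L) (Matrix.of fun i j : Fin 2 => if i.val + j.val + 1 = 2 then (1 : L) else 0) (IsCMField.complexConj_ne_one L) w hw) γ ∈ B)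
    (hst : IsLocalStablyConjH L v (γ, (1 : (UnitaryGroup.cmDatum L 1 (Matrix.of fun i j : Fin 1 => if i.val + j.val + 1 = 1 then (1 : L) else 0)).Local v)) (δ, (1 : (UnitaryGroup.cmDatum L 1 (Matrix.of fun i j : Fin 1 => if i.val + j.val + 1 = 1 then (1 : L) else 0)).Local v))) :
    IsLocalStablyConjH L v ((localNonsplitEquiv (IsCMField.complexConj L) (Matrix.of fun i j : Fin 2 => if i.val + j.val + 1 = 2 then (1 : L) else 0) (IsCMField.complexConj_ne_one L) w hw).symm (Ψ ((localNonsplitEquiv (IsCMField.complexConj L) (Matrix.of fun i j : Fin 2 => if i.val + j.val + 1 = 2 then (1 : L) else 0) (IsCMField.complexConj_ne_one L) w hw) γ)), (1 : (UnitaryGroup.cmDatum L 1 (Matrix.of fun i j : Fin 1 => if i.val + j.val + 1 = 1 then (1 : L) else 0)).Local v)) ((localNonsplitEquiv (IsCMField.complexConj L) (Matrix.of fun i j : Fin 2 => if i.val + j.val + 1 = 2 then (1 : L) else 0) (IsCMField.complexConj_ne_one L) w hw).symm (Ψ ((localNonsplitEquiv (IsCMField.complexConj L) (Matrix.of fun i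 j : Fin 2 => if i.val + j.val + 1 = 2 then (1 : L) else 0) (IsCMField.complexConj_ne_one L) w hw) δ)), (1 : (UnitaryGroup.cmDatum L 1 (Matrix.of fun i j : Fin 1 => if i.val + j.val + 1 = 1 then (1 : L) else 0)).Local v)) := by
  obtain ⟨x, hx⟩ := isConj_iff.1 (isConj_coe_localNonsplitEquiv_of_isLocalStablyConjH L w hw hst)
  have hmat : ((((localNonsplitEquiv (IsCMField.complexConj L) (Matrix.of fun i j : Fin 2 => if i.val + j.val + 1 = 2 then (1 : L) else 0) (IsCMField.complexConj_ne_one L) w hw) δ : ↥(unitaryGroupOfForm (galAdicCompletionMap (L := L) (IsCMField.complexConj L) hw) (placeForm (Matrix.of fun i j : Fin 2 => if i.val + j.val + 1 = 2 then (1 : L) else 0) w.1))) : GL (Fin 2) (w.1.adicCompletion L)) : Matrix (Fin 2) (Fin 2) (w.1.adicCompletion L)) = (x : Matrix (Fin 2) (Fin 2) (w.1.adicCompletion L)) * ((((localNonsplitEquiv (IsCMField.complexConj L) (Matrix.of fun i j : Fin 2 => if i.val + j.val + 1 = 2 then (1 : L) else 0) (IsCMField.complexConj_ne_one L) w hw)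 γ : ↥(unitaryGroupOfForm (galAdicCompletionMap (L := L) (IsCMField.complexConj L) hw) (placeForm (Matrix.of fun i j : Fin 2 => if i.val + j.val + 1 = 2 then (1 : L) else 0) w.1))) : GL (Fin 2) (w.1.adicCompletion L)) : Matrix (Fin 2) (Fin 2) (w.1.adicCompletion L)) *
      ((x⁻¹ : GL (Fin 2) (w.1.adicCompletion L)) : Matrix (Fin 2) (Fin 2) (w.1.adicCompletion L)) := by
    rw [← hx, Units.val_mul, Units.val_mul]
  have key := coe_cayleyScaling_eq_conj _ _ hB hΨ hsρ x hmat hγ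
  refine isLocalStablyConjH_of_isConj_coe_localNonsplitEquiv L w hw (isConj_iff.2 ⟨x, Units.ext ?_⟩)
  rw [ContinuousMulEquiv.apply_symm_apply, ContinuousMulEquiv.apply_symm_apply, Units.val_mul, Units.val_mul, key]

include hB hΨ hB' in
set_option maxHeartbeats 800000 in
/-- **(I)**: `Ψ_G` is injective on `U₀` (the `s⁻¹`-scaling `Θ` is a left inverse on `B`, ★ `cayleyScaling_left_inv`). [cite: PlatonovRapinchuk1994, §3.3] -/
theorem injOn_map (h2 : (2 : w.1.adicCompletion L) ≠ 0) (hs0 : s ≠ 0) (hsρ : ‖s‖ * ρ < 1)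
    (hΘ1 : ∀ u ∈ B', (((Θ u : ↥(unitaryGroupOfForm (galAdicCompletionMap (L := L) (IsCMField.complexConj L) hw) (placeForm (Matrix.of fun i j : Fin 2 => if i.val + j.val + 1 = 2 then (1 : L) else 0) w.1))) : GL (Fin 2) (w.1.adicCompletion L)) : Matrix (Fin 2) (Fin 2) (w.1.adicCompletion L)) = cayley (s⁻¹ • (((((u : ↥(unitaryGroupOfForm (galAdicCompletionMap (L := L) (IsCMField.complexConj L) hw) (placeForm (Matrix.of fun i j : Fin 2 => if i.val + j.val + 1 = 2 then (1 : L) else 0) w.1))) : GL (Fin 2) (w.1.adicCompletion L)) : Matrix (Fin 2) (Fin 2) (w.1.adicCompletion L)) - 1) * ((((u : ↥(unitaryGroupOfForm (galAdicCompletionMap (L := L) (IsCMField.complexConj L) hw) (placeForm (Matrix.of fun i j : Fin 2 => if i.val + j.val + 1 = 2 then (1 : L) else 0) w.1))) : GL (Fin 2) (w.1.adicCompletion L)) : Matrix (Fin 2) (Fin 2) (w.1.adicCompletion L)) + 1)⁻¹))) {γ δ : (UnitaryGroup.cmDatum L 2 (Matrix.of fun i j : Fin 2 => if i.val + j.val +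 1 = 2 then (1 : L) else 0)).Local v} (hγ : (localNonsplitEquiv (IsCMField.complexConj L) (Matrix.of fun i j : Fin 2 => if i.val + j.val + 1 = 2 then (1 : L) else 0) (IsCMField.complexConj_ne_one L) w hw) γ ∈ B) (hδ : (localNonsplitEquiv (IsCMField.complexConj L) (Matrix.of fun i j : Fin 2 => if i.val + j.val + 1 = 2 then (1 : L) else 0) (IsCMField.complexConj_ne_one L) w hw) δ ∈ B)
    (h : (localNonsplitEquiv (IsCMField.complexConj L) (Matrix.of fun i j : Fin 2 => if i.val + j.val + 1 = 2 then (1 : L) else 0) (IsCMField.complexConj_ne_one L) w hw).symm (Ψ ((localNonsplitEquiv (IsCMField.complexConj L) (Matrix.of fun i j : Fin 2 => if i.val + j.val + 1 = 2 then (1 : L) else 0) (IsCMField.complexConj_ne_one L) w hw) γ)) = (localNonsplitEquiv (IsCMField.complexConj L) (Matrix.of fun i j : Fin 2 => if i.val + j.val + 1 = 2 then (1 : L) else 0) (IsCMField.complexConj_ne_one L) w hw).symm (Ψ ((localNonsplitEquiv (IsCMField.complexConj L) (Matrix.of fun i j : Fin 2 => if i.val + j.val + 1 = 2 then (1 : L)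 else 0) (IsCMField.complexConj_ne_one L) w hw) δ))) : γ = δ := by
  have hγ' := cayleyScaling_left_inv _ _ hB hΨ h2 hs0 hsρ le_rfl hB' hΘ1 hγ
  have hδ' := cayleyScaling_left_inv _ _ hB hΨ h2 hs0 hsρ le_rfl hB' hΘ1 hδ
  have heq : Ψ ((localNonsplitEquiv (IsCMField.complexConj L) (Matrix.of fun i j : Fin 2 => if i.val + j.val + 1 = 2 then (1 : L) else 0) (IsCMField.complexConj_ne_one L) w hw) γ) = Ψ ((localNonsplitEquiv (IsCMField.complexConj L) (Matrix.of fun i j : Fin 2 => if i.val + j.val + 1 = 2 then (1 : L) else 0) (IsCMField.complexConj_ne_one L) w hw) δ) := (localNonsplitEquiv (IsCMField.complexConj L) (Matrix.of fun i j : Fin 2 => if i.val + j.val + 1 = 2 then (1 : L) else 0) (IsCMField.complexConj_ne_one L) w hw).symm.injective h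
  apply (localNonsplitEquiv (IsCMField.complexConj L) (Matrix.of fun i j : Fin 2 => if i.val + j.val + 1 = 2 then (1 : L) else 0) (IsCMField.complexConj_ne_one L) w hw).injective
  rw [← hγ', ← hδ', heq]

include hB hΨ hB' hΘ in
set_option maxHeartbeats 800000 in
/-- **(Sst)**: every STABLE conjugate `η` of `Ψ_G γ` (`γ ∈ U₀`) is `Ψ_G δ` for a stable conjugate `δ ∈ U₀` of `γ` — `δ := e⁻¹(Θ(e η))` (§1 `coe_inverse_eq_conj`, §2).
[cite: Rogawski1990, §3.1 p. 19] [cite: PlatonovRapinchuk1994, §3.3] -/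
theorem exists_isLocalStablyConjH_map_eq (h2 : (2 : w.1.adicCompletion L) ≠ 0) (hs0 : s ≠ 0) (hsρ : ‖s‖ * ρ < 1) (hρ1 : ρ < 1)
    {γ : (UnitaryGroup.cmDatum L 2 (Matrix.of fun i j : Fin 2 => if i.val + j.val + 1 = 2 then (1 : L) else 0)).Local v} (hγ : (localNonsplitEquiv (IsCMField.complexConj L) (Matrix.of fun i j : Fin 2 => if i.val + j.val + 1 = 2 then (1 : L) else 0) (IsCMField.complexConj_ne_one L) w hw) γ ∈ B) (η : (UnitaryGroup.cmDatum L 2 (Matrix.of fun i j : Fin 2 => if i.val + j.val + 1 = 2 then (1 : L) else 0)).Local v)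
    (hst : IsLocalStablyConjH L v ((localNonsplitEquiv (IsCMField.complexConj L) (Matrix.of fun i j : Fin 2 => if i.val + j.val + 1 = 2 then (1 : L) else 0) (IsCMField.complexConj_ne_one L) w hw).symm (Ψ ((localNonsplitEquiv (IsCMField.complexConj L) (Matrix.of fun i j : Fin 2 => if i.val + j.val + 1 = 2 then (1 : L) else 0) (IsCMField.complexConj_ne_one L) w hw) γ)), (1 : (UnitaryGroup.cmDatum L 1 (Matrix.of fun i j : Fin 1 => if i.val + j.val + 1 = 1 then (1 : L) else 0)).Local v)) (η, (1 : (UnitaryGroup.cmDatum L 1 (Matrix.of fun i j : Fin 1 => if i.val + j.val + 1 = 1 then (1 : L) else 0)).Local v))) :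
    ∃ δ : (UnitaryGroup.cmDatum L 2 (Matrix.of fun i j : Fin 2 => if i.val + j.val + 1 = 2 then (1 : L) else 0)).Local v, (localNonsplitEquiv (IsCMField.complexConj L) (Matrix.of fun i j : Fin 2 => if i.val + j.val + 1 = 2 then (1 : L) else 0) (IsCMField.complexConj_ne_one L) w hw) δ ∈ B ∧ IsLocalStablyConjH L v (γ, (1 : (UnitaryGroup.cmDatum L 1 (Matrix.of fun i j : Fin 1 => if i.val + j.val + 1 = 1 then (1 : L) else 0)).Local v)) (δ, (1 : (UnitaryGroup.cmDatum L 1 (Matrix.of fun i j : Fin 1 => if i.val + j.val + 1 = 1 then (1 : L) else 0)).Local v)) ∧ (localNonsplitEquiv (IsCMField.complexConj L) (Matrix.of fun i j : Fin 2 => if i.val + j.val + 1 = 2 then (1 : L) else 0) (IsCMField.complexConj_ne_one L) w hw).symm (Ψ ((localNonsplitEquiv (IsCMField.complexConj L) (Matrix.of fun i j : Fin 2 => if i.val + j.val + 1 = 2 then (1 : L) else 0) (IsCMField.complexConj_ne_one L) w hw) δ)) = η := by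
  obtain ⟨x, hx⟩ := isConj_iff.1 (isConj_coe_localNonsplitEquiv_of_isLocalStablyConjH L w hw hst)
  rw [ContinuousMulEquiv.apply_symm_apply] at hx
  have hmat : ((((localNonsplitEquiv (IsCMField.complexConj L) (Matrix.of fun i j : Fin 2 => if i.val + j.val + 1 = 2 then (1 : L) else 0) (IsCMField.complexConj_ne_one L) w hw) η : ↥(unitaryGroupOfForm (galAdicCompletionMap (L := L) (IsCMField.complexConj L) hw) (placeForm (Matrix.of fun i j : Fin 2 => if i.val + j.val + 1 = 2 then (1 : L) else 0) w.1))) : GL (Fin 2) (w.1.adicCompletion L)) : Matrix (Fin 2) (Fin 2) (w.1.adicCompletion L)) = (x : Matrix (Fin 2) (Fin 2) (w.1.adicCompletion L)) * (((Ψ ((localNonsplitEquiv (IsCMField.complexConj L) (Matrix.of fun i j : Fin 2 => if i.val + j.val + 1 = 2 then (1 : L) else 0) (IsCMField.complexConj_ne_one L) w hw) γ) : ↥(unitaryGroupOfForm (galAdicCompletionMap (L := L) (IsCMField.complexConj L) hw) (placeForm (Matrix.of fun i j : Fin 2 => if i.val + j.val + 1 = 2 then (1 : L) else 0) w.1)))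 : GL (Fin 2) (w.1.adicCompletion L)) : Matrix (Fin 2) (Fin 2) (w.1.adicCompletion L)) *
      ((x⁻¹ : GL (Fin 2) (w.1.adicCompletion L)) : Matrix (Fin 2) (Fin 2) (w.1.adicCompletion L)) := by
    rw [← hx, Units.val_mul, Units.val_mul]
  obtain ⟨hmem, hinv, hconj⟩ := coe_inverse_eq_conj _ _ hB hΨ hB' hΘ h2 hs0 hsρ hρ1 hγ x hmat
  refine ⟨(localNonsplitEquiv (IsCMField.complexConj L) (Matrix.of fun i j : Fin 2 => if i.val + j.val + 1 = 2 then (1 : L) else 0) (IsCMField.complexConj_ne_one L) w hw).symm (Θ ((localNonsplitEquiv (IsCMField.complexConj L) (Matrix.of fun i j : Fin 2 => if i.val + j.val + 1 = 2 then (1 : L) else 0) (IsCMField.complexConj_ne_one L) w hw) η)), by rwa [ContinuousMulEquiv.apply_symm_apply], ?_, ?_⟩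
  · refine isLocalStablyConjH_of_isConj_coe_localNonsplitEquiv L w hw (isConj_iff.2 ⟨x, Units.ext ?_⟩)
    rw [ContinuousMulEquiv.apply_symm_apply, Units.val_mul, Units.val_mul, hconj]
  · rw [ContinuousMulEquiv.apply_symm_apply, hinv, ContinuousMulEquiv.symm_apply_apply]

end Clauses

end Summit.HodgeConjecture.HodgeConjecture.Cruxes.H413.K2E3CayleyScalingRankOneStable

end
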